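import Summits.CriticalPhenomena.CardyFormulaZ2.Theorems.HalfPlaneOneArmThird.Negative.Basics
import Literature.Probability.Percolation.RSWProofs
import Literature.Probability.Percolation.LatticeSymmetry
import Literature.Probability.Percolation.KestenTheoremProofs
import Literature.Probability.Percolation.SharpnessDCTProofs
import Literature.Probability.Percolation.ZdOneArmPowerBound

/-!
# `HalfPlaneOneArmThird` (stmt-CriticalPhenomena-5662), negative side II: subcritical divergence and
# the rigorous window `α₀ ≤ β ≤ 1` at `p = 1/2`

Part II of the negative-side support for the crux `HalfPlaneOneArmThird` (see `Basics.lean`).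

* `not_exponentAt_of_lt_half`: for `0 < p < 1/2` the crux sequence `log P_p[armEvt n] / log n` tends
  to `-∞` (`tendsto_atBot_of_lt_half`), so NO exponent exists: `armEvt n ⊆ {0 ↔ ∂B(n)}`
  (`armEvt_subset_siteToBoundary`), Kesten's theorem `p_c(ℤ²) = 1/2` (`kesten_criticalProb_Z2_holds`)
  and sharpness (`DCT16.perc_sharpness_holds`) give `P_n ≤ e^{-cn}`, and `log n ≤ 2√n`.
* `exponentAt_half_window`: `ExponentAt half β → α₀ ≤ β ≤ 1`.  Lower edge (`exponentAt_half_lower`):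
  the tree's a-priori one-arm bound `P ≤ C (r/R)^α` (`exists_real_boxToFar_le_rpow_of_le_half`,
  Nolin 2008 Prop. 14) with `r = 1`, `R = n - 1`.  Upper edge (`exponentAt_half_le_one`): RSW —
  `(n+1) P_n ≥ 1/2` (`half_le_succ_mul_prob`): a top–bottom open crossing of the `n × n` square
  (probability `≥ 1/2`, `crossingProb_half_succ_self_holds` + `real_tbCrossing`) starts at one of the
  `n + 1` bottom sites `x`, and re-centred at `x` it is a crux arm (`tbCrossing_subset_biUnion`, no
  first-exit argument needed), union bound + translation invariance (`real_openCrossing_shift`) — the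
  proof pattern of the tree's `crossingProb_succ_le`.  The crux value `1/3` lies strictly inside
  `[α₀, 1]`; with the universal `β₂⁺ = 1`, `β₃⁺ = 2` this is all the rigorous `ℤ²` theory constrains.
-/

noncomputable section

namespace Summit.CriticalPhenomena.CardyFormulaZ2.Theorems.HalfPlaneOneArmThird.Negative

open MeasureTheory ProbabilityTheory Filter Topology
open Literature.Probability.Percolation Literature.Probability.LatticeModels

/-! ### Subcritical `0 < p < 1/2`: the sequence diverges to `-∞`, no exponent exists -/

/-- The half-box lies in the box `B(n) = [-n, n]²`. -/
theorem halfBox_subset_box (n : ℕ) : halfBox n ⊆ (↑(box 2 n) : Set (Site 2)) := by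
  intro v hv
  simp only [halfBox, Set.mem_setOf_eq] at hv
  simp only [Finset.mem_coe, mem_box, Fin.forall_fin_two]
  omega

/-- The crux event implies the tree's full-plane one-arm event `{0 ↔ ∂B(n)}` (`siteToBoundary`). -/
theorem armEvt_subset_siteToBoundary (n : ℕ) : armEvt n ⊆ siteToBoundary 2 n := by
  rintro ω ⟨y, hy, h0, hyS, hr⟩
  refine ⟨y, ?_, openConnIn_mono (halfBox_subset_box n) 0 y ⟨h0, hyS, hr⟩⟩
  rw [mem_innerBoundary_iff]
  refine ⟨halfBox_subset_box n hyS, ?_⟩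
  have hyB : y ∈ halfBox n := hyS
  simp only [halfBox, Set.mem_setOf_eq] at hyB
  have h10 : (1 : Fin 2) ≠ 0 := by decide
  have h01 : (0 : Fin 2) ≠ 1 := by decide
  rcases hy with hy | hy | hy
  · refine ⟨y + Pi.single 0 1, ?_, (zdGraph_adj_iff _ _).2 ⟨0, Or.inl rfl⟩⟩
    simp only [mem_box, Fin.forall_fin_two, Pi.add_apply, Pi.single_eq_same,
      Pi.single_eq_of_ne h10]
    omega
  · refine ⟨y - Pi.single 0 1, ?_, (zdGraph_adj_iff _ _).2 ⟨0, Or.inr (by rw [sub_add_cancel])⟩⟩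
    simp only [mem_box, Fin.forall_fin_two, Pi.sub_apply, Pi.single_eq_same,
      Pi.single_eq_of_ne h10]
    omega
  · refine ⟨y + Pi.single 1 1, ?_, (zdGraph_adj_iff _ _).2 ⟨1, Or.inl rfl⟩⟩
    simp only [mem_box, Fin.forall_fin_two, Pi.add_apply, Pi.single_eq_same,
      Pi.single_eq_of_ne h01]
    omega

/-- **Sharpness transfers**: for `p < 1/2 = p_c(ℤ²)` (Kesten, proved in the tree) the crux
probability decays exponentially, `P_p[armEvt n] ≤ e^{-c n}` (Menshikov / Aizenman–Barsky /
Duminil-Copin–Tassion, `DCT16.perc_sharpness_holds`). -/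
theorem prob_le_exp_of_lt_half {p : unitInterval} (hp : (p : ℝ) < 1 / 2) :
    ∃ c : ℝ, 0 < c ∧ ∀ n : ℕ, prob p n ≤ Real.exp (-c * n) := by
  have hpc : (p : ℝ) < criticalProb (zdGraph 2) 0 := by
    rw [show criticalProb (zdGraph 2) 0 = 1 / 2 from kesten_criticalProb_Z2_holds]; exact hp
  obtain ⟨c, hc, h⟩ := DCT16.perc_sharpness_holds (d := 2) le_rfl p hpc
  exact ⟨c, hc, fun n => (measureReal_mono (armEvt_subset_siteToBoundary n)).trans (h n)⟩

/-- `log n ≤ 2 √n`, in `rpow` form. -/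
theorem log_le_two_mul_rpow_half (n : ℕ) : Real.log n ≤ 2 * (n : ℝ) ^ (1 / 2 : ℝ) := by
  have := Real.log_le_rpow_div (Nat.cast_nonneg n) (by norm_num : (0 : ℝ) < 1 / 2)
  linarith

/-- For `0 < p < 1/2` the crux sequence `log P_n / log n` tends to `-∞`. -/
theorem tendsto_atBot_of_lt_half {p : unitInterval} (hp0 : 0 < (p : ℝ)) (hp : (p : ℝ) < 1 / 2) :
    Tendsto (fun n : ℕ ↦ Real.log (prob p n) / Real.log n) atTop atBot := by
  obtain ⟨c, hc, h⟩ := prob_le_exp_of_lt_half hp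
  have hcmp : ∀ᶠ n : ℕ in atTop,
      Real.log (prob p n) / Real.log n ≤ -((c / 2) * (n : ℝ) ^ (1 / 2 : ℝ)) := by
    filter_upwards [eventually_ge_atTop 2] with n hn
    have hn' : (2 : ℝ) ≤ n := by exact_mod_cast hn
    have hnpos : (0 : ℝ) < n := by linarith
    have hlog : 0 < Real.log n := Real.log_pos (by linarith)
    have hP : 0 < prob p n := prob_pos hp0 n
    have h1 : Real.log (prob p n) ≤ -c * n := by
      rw [Real.log_le_iff_le_exp hP]; exact h n
    have h2 := log_le_two_mul_rpow_half n
    have h4 : (n : ℝ) ^ (1 / 2 : ℝ) * (n : ℝ) ^ (1 / 2 : ℝ) = n := by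
      rw [← Real.rpow_add hnpos, add_halves, Real.rpow_one]
    have h6 : 0 ≤ c / 2 * (n : ℝ) ^ (1 / 2 : ℝ) := by positivity
    have h7 : c / 2 * (n : ℝ) ^ (1 / 2 : ℝ) * Real.log n ≤
        c / 2 * (n : ℝ) ^ (1 / 2 : ℝ) * (2 * (n : ℝ) ^ (1 / 2 : ℝ)) :=
      mul_le_mul_of_nonneg_left h2 h6
    have h8 : c / 2 * (n : ℝ) ^ (1 / 2 : ℝ) * (2 * (n : ℝ) ^ (1 / 2 : ℝ)) = c * n := by
      have : c / 2 * (n : ℝ) ^ (1 / 2 : ℝ) * (2 * (n : ℝ) ^ (1 / 2 : ℝ)) =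
          c * ((n : ℝ) ^ (1 / 2 : ℝ) * (n : ℝ) ^ (1 / 2 : ℝ)) := by ring
      rw [this, h4]
    rw [div_le_iff₀ hlog]
    linarith
  refine tendsto_atBot_mono' atTop hcmp ?_
  have hs : Tendsto (fun n : ℕ => (n : ℝ) ^ (1 / 2 : ℝ)) atTop atTop :=
    (tendsto_rpow_atTop (by norm_num : (0 : ℝ) < 1 / 2)).comp tendsto_natCast_atTop_atTop
  exact tendsto_neg_atTop_atBot.comp (hs.const_mul_atTop (by positivity : (0 : ℝ) < c / 2))

/-- **(a) Subcritical parameters are refuted outright**: for `0 < p < 1/2` the statement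
`log P_p[armEvt n] / log n → -β` is false for EVERY `β` (the sequence diverges to `-∞`).  Any proof
of the crux must use that `1/2` is not subcritical, i.e. `p_c(ℤ²) ≤ 1/2` (Kesten's theorem). -/
theorem not_exponentAt_of_lt_half {p : unitInterval} (hp0 : 0 < (p : ℝ)) (hp : (p : ℝ) < 1 / 2)
    (β : ℝ) : ¬ ExponentAt p β :=
  not_tendsto_nhds_of_tendsto_atBot (tendsto_atBot_of_lt_half hp0 hp) _

/-! ## (b) The window at criticality: `α₀ ≤ β ≤ 1` -/

/-- The crux event at scale `n ≥ 1` implies the tree's "box-to-far" event with `r = 1`,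
`R = n - 1`: `0 ∈ B(1)` is joined to a site outside `B(n-1)`. -/
theorem armEvt_subset_boxToFar {n : ℕ} (hn : 1 ≤ n) :
    armEvt n ⊆ {ω | ∃ x ∈ box 2 1, ∃ y ∉ box 2 (n - 1), ω ∈ openConnIn Set.univ x y} := by
  rintro ω ⟨y, hy, h⟩
  refine ⟨0, by simp [mem_box], y, ?_, openConnIn_mono (Set.subset_univ _) 0 y h⟩
  intro hyb
  rw [mem_box] at hyb
  have h0 := hyb 0
  have h1 := hyb 1
  push_cast [Nat.cast_sub hn] at h0 h1
  omega

/-- **A-priori upper bound** (Nolin 2008 Prop. 14, `j = 1`, upper half; tree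
`exists_real_boxToFar_le_rpow_of_le_half`): `P_{1/2}[armEvt n] ≤ C (2/n)^α` for `n ≥ 2`, with the
tree's constants `C, α > 0`. -/
theorem prob_half_le_rpow :
    ∃ C α : ℝ, 0 < C ∧ 0 < α ∧ ∀ n : ℕ, 2 ≤ n → prob half n ≤ C * ((2 : ℝ) / n) ^ α := by
  obtain ⟨C, α, hC, hα, h⟩ := exists_real_boxToFar_le_rpow_of_le_half
  refine ⟨C, α, hC, hα, fun n hn => ?_⟩
  have h1 : 1 ≤ n - 1 := by omega
  have hb := h half (by simp) 1 (n - 1) le_rfl h1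
  have hsub := armEvt_subset_boxToFar (n := n) (by omega)
  refine ((measureReal_mono hsub).trans hb).trans ?_
  have hn' : (2 : ℝ) ≤ n := by exact_mod_cast hn
  have hcast : ((n - 1 : ℕ) : ℝ) = n - 1 := by
    rw [Nat.cast_sub (by omega : 1 ≤ n)]; simp
  rw [hcast, Nat.cast_one]
  have hfrac : (1 : ℝ) / (n - 1) ≤ 2 / n := by
    rw [div_le_div_iff₀ (by linarith) (by linarith)]; linarith
  exact mul_le_mul_of_nonneg_left
    (Real.rpow_le_rpow (div_nonneg zero_le_one (by linarith)) hfrac hα.le) hC.le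

/-- **(b, lower edge of the window)** any half-plane one-arm exponent of bond-`ℤ²` at `p = 1/2` is
at least the tree's a-priori exponent `α₀ > 0`: `ExponentAt half β → α₀ ≤ β`.  (The crux value
`1/3` is not excluded: `α₀` is a tiny RSW constant.) -/
theorem exponentAt_half_lower : ∃ α : ℝ, 0 < α ∧ ∀ β : ℝ, ExponentAt half β → α ≤ β := by
  obtain ⟨C, α, hC, hα, h⟩ := prob_half_le_rpow
  refine ⟨α, hα, fun β hβ => ?_⟩
  set K : ℝ := Real.log C + α * Real.log 2 with hK
  have hg : Tendsto (fun n : ℕ => K / Real.log n - α) atTop (𝓝 (0 - α)) :=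
    (tendsto_const_nhds.div_atTop (Real.tendsto_log_atTop.comp tendsto_natCast_atTop_atTop)).sub tendsto_const_nhds
  rw [zero_sub] at hg
  have hcmp : ∀ᶠ n : ℕ in atTop, Real.log (prob half n) / Real.log n ≤ K / Real.log n - α := by
    filter_upwards [eventually_ge_atTop 2] with n hn
    have hn' : (2 : ℝ) ≤ n := by exact_mod_cast hn
    have hlog : 0 < Real.log n := Real.log_pos (by linarith)
    have hP : 0 < prob half n := prob_pos (by simp) n
    have h2n : 0 < (2 : ℝ) / n := by positivity
    have hle : Real.log (prob half n) ≤ K - α * Real.log n := by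
      have := Real.log_le_log hP (h n hn)
      rw [Real.log_mul hC.ne' (Real.rpow_pos_of_pos h2n α).ne', Real.log_rpow h2n,
        Real.log_div (by norm_num) (by positivity)] at this
      rw [hK]; linarith
    rw [div_sub' (ne_of_gt hlog), div_le_div_iff_of_pos_right hlog]
    linarith
  have := le_of_tendsto_of_tendsto hβ hg hcmp
  linarith

/-- The outer boundary of the half-box, as a set of sites. -/
def tgt (n : ℕ) : Set (Site 2) := {y | y 0 = (n : ℤ) ∨ y 0 = -(n : ℤ) ∨ y 1 = (n : ℤ)}

/-- The crux event is the tree's open crossing event from `{0}` to `tgt n` inside the half-box. -/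
theorem armEvt_eq_openCrossing (n : ℕ) :
    armEvt n = openCrossing (halfBox n) {(0 : Site 2)} (tgt n) := by
  ext ω
  simp [armEvt, tgt]

/-- A top–bottom open crossing of the square `[0, n]²` re-centred at its starting point `x` on the
bottom side is a crux arm in the translated half-box `x + [-n, n] × [0, n]` (no first-exit
argument: `[0, n]² - x ⊆ [-n, n] × [0, n]` for `0 ≤ x₀ ≤ n`). -/
theorem tbCrossing_subset_biUnion (n : ℕ) :
    tbCrossing n n ⊆ ⋃ x ∈ bottomSide n n,
      openCrossing ((· + x) '' halfBox n) ((· + x) '' {(0 : Site 2)}) ((· + x) '' tgt n) := by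
  rintro ω ⟨x, hx, y, hy, hconn⟩
  simp only [Finset.mem_coe, bottomSide, topSide, Finset.mem_filter, mem_rectangle_iff] at hx hy
  refine Set.mem_biUnion (x := x) ?_ ?_
  · simp only [Finset.mem_coe, bottomSide, Finset.mem_filter, mem_rectangle_iff]; exact hx
  refine ⟨x, ⟨0, rfl, zero_add x⟩, y, ⟨y - x, ?_, sub_add_cancel y x⟩, openConnIn_mono ?_ x y hconn⟩
  · simp only [tgt, Set.mem_setOf_eq, Pi.sub_apply]; omega
  · intro v hv
    simp only [Finset.mem_coe, mem_rectangle_iff] at hv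
    refine ⟨v - x, ?_, sub_add_cancel v x⟩
    simp only [halfBox, Set.mem_setOf_eq, Pi.sub_apply]; omega

/-- `|bottomSide n n| ≤ n + 1`. -/
theorem card_bottomSide_le (n : ℕ) : (bottomSide n n).card ≤ n + 1 := by
  have hsub : bottomSide n n ⊆ (Finset.range (n + 1)).image fun k : ℕ => (![(k : ℤ), 0] : Site 2) := by
    intro x hx
    simp only [bottomSide, Finset.mem_filter, mem_rectangle_iff] at hx
    obtain ⟨⟨h0, h1, -, -⟩, h2⟩ := hx
    refine Finset.mem_image.2 ⟨(x 0).toNat, Finset.mem_range.2 (by omega), ?_⟩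
    ext i; fin_cases i
    · simp only [Fin.zero_eta, Matrix.cons_val_zero]; exact Int.toNat_of_nonneg h0
    · simp [h2]
  exact (Finset.card_le_card hsub).trans (Finset.card_image_le.trans (Finset.card_range _).le)

/-- **RSW lower bound**: `(n + 1) · P_{1/2}[armEvt n] ≥ 1/2` — a top–bottom crossing of the square
(probability `≥ 1/2`, Bollobás–Riordan Cor. 3(iii), `crossingProb_half_succ_self_holds` +
transposition) starts at one of the `n + 1` bottom sites, and translation invariance. -/
theorem half_le_succ_mul_prob (n : ℕ) : (1 : ℝ) / 2 ≤ (n + 1) * prob half n := by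
  calc (1 : ℝ) / 2 ≤ crossingProb half n n :=
        half_le_crossingProb_self crossingProb_half_succ_self_holds n
    _ = (bondPercolation (zdGraph 2) half).real (tbCrossing n n) := (real_tbCrossing half n n).symm
    _ ≤ (bondPercolation (zdGraph 2) half).real (⋃ x ∈ bottomSide n n,
          openCrossing ((· + x) '' halfBox n) ((· + x) '' {(0 : Site 2)}) ((· + x) '' tgt n)) :=
        measureReal_mono (tbCrossing_subset_biUnion n) (measure_ne_top _ _)
    _ ≤ ∑ x ∈ bottomSide n n, (bondPercolation (zdGraph 2) half).real
          (openCrossing ((· + x) '' halfBox n) ((· + x) '' {(0 : Site 2)}) ((· + x) '' tgt n)) :=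
        measureReal_biUnion_finset_le _ _
    _ = ∑ _x ∈ bottomSide n n, prob half n := by
        refine Finset.sum_congr rfl fun x _ => ?_
        rw [real_openCrossing_shift, prob, armEvt_eq_openCrossing]
    _ = (bottomSide n n).card * prob half n := by rw [Finset.sum_const, nsmul_eq_mul]
    _ ≤ (n + 1) * prob half n := by
        gcongr
        · exact prob_nonneg half n
        · exact_mod_cast card_bottomSide_le n

/-- **(b, upper edge of the window)** any half-plane one-arm exponent of bond-`ℤ²` at `p = 1/2` is
at most `1`: `ExponentAt half β → β ≤ 1` (`P_n ≥ 1/(4n)`).  With the universal half-plane exponents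
`β₂⁺ = 1`, `β₃⁺ = 2` this is all the rigorous `ℤ²` theory pins down; `1/3 ∈ [α₀, 1]`. -/
theorem exponentAt_half_le_one (β : ℝ) (hβ : ExponentAt half β) : β ≤ 1 := by
  have hg : Tendsto (fun n : ℕ => -Real.log 4 / Real.log n - 1) atTop (𝓝 (0 - 1)) :=
    (tendsto_const_nhds.div_atTop (Real.tendsto_log_atTop.comp tendsto_natCast_atTop_atTop)).sub tendsto_const_nhds
  rw [zero_sub] at hg
  have hcmp : ∀ᶠ n : ℕ in atTop, -Real.log 4 / Real.log n - 1 ≤ Real.log (prob half n) / Real.log n := by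
    filter_upwards [eventually_ge_atTop 2] with n hn
    have hn' : (2 : ℝ) ≤ n := by exact_mod_cast hn
    have hlog : 0 < Real.log n := Real.log_pos (by linarith)
    have hP : (1 : ℝ) / (4 * n) ≤ prob half n := by
      have := half_le_succ_mul_prob n
      rw [div_le_iff₀ (by positivity)]
      nlinarith [prob_nonneg half n]
    have hle : -Real.log 4 - Real.log n ≤ Real.log (prob half n) := by
      have := Real.log_le_log (by positivity) hP
      rw [Real.log_div (by norm_num) (by positivity), Real.log_one, Real.log_mul (by norm_num)
        (by positivity)] at this
      linarith
    rw [div_sub' (ne_of_gt hlog), div_le_div_iff_of_pos_right hlog]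
    linarith
  have := le_of_tendsto_of_tendsto hg hβ hcmp
  linarith

/-- **The window, assembled**: `ExponentAt half β → α₀ ≤ β ≤ 1` for the tree's `α₀ > 0`. -/
theorem exponentAt_half_window : ∃ α : ℝ, 0 < α ∧ ∀ β : ℝ, ExponentAt half β → α ≤ β ∧ β ≤ 1 := by
  obtain ⟨α, hα, h⟩ := exponentAt_half_lower
  exact ⟨α, hα, fun β hβ => ⟨h β hβ, exponentAt_half_le_one β hβ⟩⟩

end Summit.CriticalPhenomena.CardyFormulaZ2.Theorems.HalfPlaneOneArmThird.Negative

end
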